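import Summits.ABC.ABC.Theorems.DefiniteXiFreyModularityStubNineTransfer
import Literature.NumberTheory.Automorphic.CDTTheorem722
import Literature.NumberTheory.EllipticCurves.SzpiroFreyConductorProofs
import HarnessLib

/-!
# STUB-IDEAS companion · `stub_liftThree` · ideator k3 (probe the extremes) · gen 19

Crux `FreyModularity` (stmt-ABC-11340, route-ABC-DefiniteXi), skeleton `Cruxes/FreyModularity/Lines/Sketch.lean`.

Family 3e ("perturbation from the proved neighbouring case", here the PROVED stub `stub_nineTransfer`
= Silverberg, CSS 1997 Prop. 7.1(a) at the single place `3`) applied to the ROUTE-USAGE extreme of the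
stub: the skeleton consumes `stub_liftThree` only at (i) Frey curves `E_(a,b)` and (ii) switched curves
`W'` with `W'[5] ≅ E_(a,b)[5]`.  Silverberg's Prop. 7.1(a) holds at EVERY prime `q ≠ 5` (PDF p. 540),
and the tree's local lemma `stub_nineTransfer_torsion` is already place-generic (`ℓ = 5 > 4`, any
`v ∤ 5`), so the transfer is a clone of the landed proof with `3 ↦ q`:

* `H19_1` `not_sq_dvd_conductorNorm_of_isTorsionGaloisRep_five` — Prop. 7.1(a), `N = 5`, every prime
  `q ≠ 5` (incl. `q = 2`);
* `H19_2` `not_sq_dvd_conductorNorm_freyCurve_of_ne_two` — Frey curves are semistable at odd primes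
  (`conductorNorm_freyCurve_dvd_holds`: `N ∣ 2⁸·rad`);
* `H19_3` `not_sq_dvd_conductorNorm_switched_of_freyCurve` — the switched curve of a Frey curve is
  semistable at every prime `q ∉ {2, 5}`;
* `LiftThreeSemistableAway` — the stub RESTRICTED to curves semistable outside `{2, 5}` (the only
  curves the route feeds it), and `liftThreeSemistableAway_of_stub` (restriction is weaker, `rfl`-glue).

All proofs complete (no `sorry`).  [cite: SilverbergCSS1997, Prop. 7.1(a) (PDF p. 540)]
-/

set_option linter.dupNamespace false

noncomputable section

open scoped MatrixGroups NumberField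
open Matrix Field IsDedekindDomain
open Literature.NumberTheory.EllipticCurves
open Literature.NumberTheory.Automorphic
open Literature.NumberTheory.Automorphic.BCDT
open Literature.NumberTheory.GaloisRepresentations
open Literature.NumberTheory.DiophantineGeometry
open WeierstrassCurve
open Summit.ABC.ABC.Theorems

namespace Summit.ABC.ABC.Cruxes.FreyModularity.StubIdeas.LiftThree3g19

/-- **H19.1 — Silverberg, CSS 1997, Prop. 7.1(a) with `N = 5`, at every prime `q ≠ 5`.**  If `E, E'/ℚ`
are elliptic curves with a common framed model `ρ̄` of `E[5]` and `E'[5]` and `q² ∤ N_E` for a prime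
`q ≠ 5`, then `q² ∤ N_{E'}`.  Clone of the landed `stub_nineTransfer` (`q = 3`) — the local input
`stub_nineTransfer_torsion` (`E'[5]^{I_𝔓} = 0` at an additive place `v ∤ 5`) is place-generic.
[cite: SilverbergCSS1997, Prop. 7.1(a) (PDF p. 540)] -/
theorem not_sq_dvd_conductorNorm_of_isTorsionGaloisRep_five {q : ℕ} (hq : q.Prime) (hq5 : q ≠ 5) :
    ∀ (W W' : WeierstrassCurve ℚ) [W.IsElliptic] [W'.IsElliptic] (ρ : ModPGaloisRep ℚ (ZMod 5) 2),
      W.IsTorsionGaloisRep 5 ρ → W'.IsTorsionGaloisRep 5 ρ →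
      ¬ q ^ 2 ∣ W.conductorNorm ℤ → ¬ q ^ 2 ∣ W'.conductorNorm ℤ := by
  intro W W' _ _ ρ hρ hρ' h9 h9'
  classical
  -- the place `v` of `𝓞 ℚ` above `q`, not above `5`, and a prime `𝔓 ∣ v` of `\bar ℤ`
  set v : HeightOneSpectrum (𝓞 ℚ) :=
    (Rat.HeightOneSpectrum.primesEquiv (R := 𝓞 ℚ)).symm ⟨q, hq⟩ with hv
  have hvq : (Rat.HeightOneSpectrum.primesEquiv v : ℕ) = q := by rw [hv, Equiv.apply_symm_apply]
  have h5v : ((5 : ℕ) : 𝓞 ℚ) ∉ v.asIdeal := by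
    rw [natCast_mem_asIdeal_iff_eq_primesEquiv_symm v Nat.prime_five, hv,
      (Rat.HeightOneSpectrum.primesEquiv (R := 𝓞 ℚ)).symm.injective.eq_iff]
    intro h
    have h' : q = 5 := congrArg Subtype.val h
    exact hq5 h'
  obtain ⟨𝔓, h𝔓⟩ := HeightOneSpectrum.primesAbove_nonempty v
  -- `E` is not additive at `q`, `E'` is
  have hW : ¬ W.HasAdditiveReductionAt v := by
    rw [← sq_dvd_conductorNorm_iff_hasAdditiveReductionAt W hq hvq]
    exact h9
  have hW' : W'.HasAdditiveReductionAt v := by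
    rw [← sq_dvd_conductorNorm_iff_hasAdditiveReductionAt W' hq hvq]
    exact h9'
  -- a non-zero `5`-torsion point of `E` fixed by `I_𝔓`, transported to `E'`
  haveI : Fact (Nat.Prime 5) := ⟨Nat.prime_five⟩
  obtain ⟨P₀, hP₀0, hP₀5, hP₀fix⟩ :=
    exists_ne_zero_smul_eq_of_not_hasAdditiveReductionAt W 5 h5v hW h𝔓
  set P : geomTorsion W ((5 : ℕ) : ℕ) := ⟨P₀, AddSubgroup.torsionBy.nsmul_iff.mpr hP₀5⟩ with hPdef
  obtain ⟨P', hP'0, hP'fix⟩ := exists_torsion_of_isTorsionGaloisRep hρ hρ' P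
  have hPfix : ∀ σ ∈ 𝔓.inertia (absoluteGaloisGroup ℚ), σ • P = P := fun σ hσ ↦
    Subtype.ext (by rw [AddSubgroup.torsionBy.coe_smul]; exact hP₀fix σ hσ)
  -- `P' = O` by the vanishing of `E'[5]^{I_𝔓}` at the additive place `q`
  have hP'5 : 5 • (P' : geomPoints W') = 0 := AddSubgroup.torsionBy.nsmul_iff.mp P'.2
  have hP'zero : (P' : geomPoints W') = 0 :=
    stub_nineTransfer_torsion W' Nat.prime_five (by norm_num) h5v hW' h𝔓 (P' : geomPoints W') hP'5
      (fun σ hσ ↦ by rw [← AddSubgroup.torsionBy.coe_smul, hP'fix σ (hPfix σ hσ)])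
  have hP'eq : P' = 0 := Subtype.ext hP'zero
  have hPeq : P = 0 := hP'0.mp hP'eq
  exact hP₀0 (congrArg Subtype.val hPeq)

/-- **H19.2 — a Frey curve is semistable at every odd prime**: for coprime `a, b` with `ab(a+b) ≠ 0`
and a prime `q ≠ 2`, `q² ∤ N_{E_(a,b)}` (`N ∣ 2⁸ · rad(ab(a+b))`, `conductorNorm_freyCurve_dvd_holds`,
and `rad` is squarefree). [cite: BombieriGubler2006, Ex. 12.5.10] -/
theorem not_sq_dvd_conductorNorm_freyCurve_of_ne_two {a b : ℤ} (hab : IsCoprime a b)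
    (h0 : a * b * (a + b) ≠ 0) {q : ℕ} (hq : q.Prime) (hq2 : q ≠ 2) :
    ¬ q ^ 2 ∣ (freyCurve a b).conductorNorm ℤ := by
  intro hqN
  have hdvd := conductorNorm_freyCurve_dvd_holds a b hab h0
  have h1 : q ^ 2 ∣ 2 ^ 8 * (UniqueFactorizationMonoid.radical (a * b * (a + b))).natAbs :=
    hqN.trans hdvd
  have hcop : Nat.Coprime (q ^ 2) (2 ^ 8) :=
    Nat.Coprime.pow _ _ ((Nat.coprime_primes hq Nat.prime_two).mpr hq2)
  have h2 : q ^ 2 ∣ (UniqueFactorizationMonoid.radical (a * b * (a + b))).natAbs :=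
    hcop.dvd_of_dvd_mul_left h1
  have hsq : Squarefree (UniqueFactorizationMonoid.radical (a * b * (a + b))).natAbs :=
    Int.squarefree_natAbs.mpr UniqueFactorizationMonoid.squarefree_radical
  have hu : IsUnit q := hsq q ((sq q) ▸ h2)
  exact hq.ne_one (Nat.isUnit_iff.mp hu)

/-- **H19.3 — the switched curve of a Frey curve is semistable away from `{2, 5}`**: if
`W'[5] ≅ E_(a,b)[5]` (common framed model `ρ̄`) for coprime `a, b` with `ab(a+b) ≠ 0`, then
`q² ∤ N_{W'}` for every prime `q ∉ {2, 5}` (H19.1 fed by H19.2).  This pins the local type, at every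
`q ∉ {2, 5}`, of the curves `E'` on which the skeleton invokes `stub_liftThree` after `stub_switch`.
[cite: SilverbergCSS1997, Prop. 7.1(a) (PDF p. 540)] -/
theorem not_sq_dvd_conductorNorm_switched_of_freyCurve {a b : ℤ} (hab : IsCoprime a b)
    (h0 : a * b * (a + b) ≠ 0) (W' : WeierstrassCurve ℚ) [W'.IsElliptic]
    (ρ : ModPGaloisRep ℚ (ZMod 5) 2) (hρ : (freyCurve a b).IsTorsionGaloisRep 5 ρ)
    (hρ' : W'.IsTorsionGaloisRep 5 ρ) {q : ℕ} (hq : q.Prime) (hq2 : q ≠ 2) (hq5 : q ≠ 5) :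
    ¬ q ^ 2 ∣ W'.conductorNorm ℤ := by
  haveI := isElliptic_freyCurve h0
  exact not_sq_dvd_conductorNorm_of_isTorsionGaloisRep_five hq hq5 (freyCurve a b) W' ρ hρ hρ'
    (not_sq_dvd_conductorNorm_freyCurve_of_ne_two hab h0 hq hq2)

/-- The registered stub `stub_liftThree` as a `Prop` (verbatim signature, `Lines/Sketch.lean` L157). -/
def LiftThree : Prop :=
  ∀ (W : WeierstrassCurve ℚ) [W.IsElliptic] (ρ : ModPGaloisRep ℚ (ZMod 3) 2),
    W.IsTorsionGaloisRep 3 ρ → ρ.IsAbsIrreducibleOverSqrt (-3) → ¬ 9 ∣ W.conductorNorm ℤ →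
    ρ.IsModular → W.IsModularGaloisRepTate 3

/-- **The route-usage restriction of the stub** (family 3: the extreme the route actually exercises):
`stub_liftThree` for curves SEMISTABLE AT EVERY PRIME `q ∉ {2, 5}` (and at `3`, `9 ∤ N`).  By H19.2
(call site A: the Frey curve itself) and H19.3 (call site B: the switched curve), every `W` the
skeleton feeds to `stub_liftThree` satisfies the extra binder.  In print this is still Diamond 1996
(Thm. 5.3: arbitrary behaviour at `p ≠ 3`), not Wiles 1995 Thm. 0.3 + Taylor–Wiles: at `p = 2, 5`
(`p ≡ -1 (mod 3)`) additive reduction is allowed, where Wiles' hypothesis "`ρ̄|_{D_p}` reducible or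
`ρ̄|_{I_p}` absolutely irreducible" can fail. [cite: Diamond1996, Thm. 5.3] -/
def LiftThreeSemistableAway : Prop :=
  ∀ (W : WeierstrassCurve ℚ) [W.IsElliptic] (ρ : ModPGaloisRep ℚ (ZMod 3) 2),
    W.IsTorsionGaloisRep 3 ρ → ρ.IsAbsIrreducibleOverSqrt (-3) → ¬ 9 ∣ W.conductorNorm ℤ →
    (∀ q : ℕ, q.Prime → q ≠ 2 → q ≠ 5 → ¬ q ^ 2 ∣ W.conductorNorm ℤ) →
    ρ.IsModular → W.IsModularGaloisRepTate 3

/-- The restriction is (trivially) implied by the registered stub. [folklore] -/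
theorem liftThreeSemistableAway_of_stub (h : LiftThree) : LiftThreeSemistableAway :=
  fun W _ ρ hρ hirr h9 _ hmod ↦ h W ρ hρ hirr h9 hmod

/-- Call site A of the skeleton (the Frey curve itself): the extra binder of `LiftThreeSemistableAway`
is discharged by H19.2, so the restricted stub gives the registered stub's conclusion on every Frey
curve. [folklore] -/
theorem liftThree_freyCurve_of_semistableAway (h : LiftThreeSemistableAway) {a b : ℤ}
    (hab : IsCoprime a b) (h0 : a * b * (a + b) ≠ 0) (ρ : ModPGaloisRep ℚ (ZMod 3) 2)
    (hρ : (freyCurve a b).IsTorsionGaloisRep 3 ρ)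
    (hirr : ρ.IsAbsIrreducibleOverSqrt (-3)) (h9 : ¬ 9 ∣ (freyCurve a b).conductorNorm ℤ)
    (hmod : ρ.IsModular) :
    (freyCurve a b).IsModularGaloisRepTate 3 := by
  haveI := isElliptic_freyCurve h0
  exact h (freyCurve a b) ρ hρ hirr h9
    (fun q hq hq2 _ ↦ not_sq_dvd_conductorNorm_freyCurve_of_ne_two hab h0 hq hq2) hmod

/-- Call site B of the skeleton (the switched curve `W'`, `W'[5] ≅ E_(a,b)[5]`): the extra binder is
discharged by H19.3. [folklore] -/
theorem liftThree_switched_of_semistableAway (h : LiftThreeSemistableAway) {a b : ℤ}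
    (hab : IsCoprime a b) (h0 : a * b * (a + b) ≠ 0) (W' : WeierstrassCurve ℚ) [W'.IsElliptic]
    (ρ₅ : ModPGaloisRep ℚ (ZMod 5) 2)
    (hρ₅ : (freyCurve a b).IsTorsionGaloisRep 5 ρ₅)
    (hρ₅' : W'.IsTorsionGaloisRep 5 ρ₅)
    (ρ : ModPGaloisRep ℚ (ZMod 3) 2) (hρ : W'.IsTorsionGaloisRep 3 ρ)
    (hirr : ρ.IsAbsIrreducibleOverSqrt (-3)) (h9 : ¬ 9 ∣ W'.conductorNorm ℤ) (hmod : ρ.IsModular) :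
    W'.IsModularGaloisRepTate 3 := by
  exact h W' ρ hρ hirr h9
    (fun q hq hq2 hq5 ↦ not_sq_dvd_conductorNorm_switched_of_freyCurve hab h0 W' ρ₅ hρ₅ hρ₅' hq hq2 hq5)
    hmod

end Summit.ABC.ABC.Cruxes.FreyModularity.StubIdeas.LiftThree3g19

end
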